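import Literature.NumberTheory.IwasawaTheory.ClassicalMuInvariant
import Literature.NumberTheory.EllipticCurves.ZpExtensionLayersLocalSymbolProofs
import Literature.NumberTheory.GaloisRepresentations.DecomposedGenericInfinite
import HarnessLib

/-!
# The layers of a `ℤ_p`-extension with Fukuda index `n₀`: every prime of `K_m` is UNRAMIFIED over `K` or TOTALLY RAMIFIED
# over `K_n` (`n₀ ≤ n ≤ m`) — the inertia dichotomy in `Gal(K_m/K)` (Washington §13.3, set-up of Lemma 13.15; Fukuda 1994)

Topic `NumberTheory/IwasawaTheory` (namespace = path). THEOREM-ONLY file (no definition, no named fact, no `sorry`), written by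
the prover seat `bsd-potss-k8t-c4` g19 (cell `bsd-potss`; Fukuda road of stmt-BirchSwinnertonDyer-19982; closes nothing). Brick (R)
of the finite-level proof of `fukuda1994_thm1_classNumberPExp_const_of_succ_eq` (`ClassicalMuInvariant.lean` §5) planned in
`run/shared/lean/pub/bsd-potss/k8t-c4/g19/SCOPE-fukuda1994-thm1-holds-k8t-c4-g19.md` (bricks (N) `FukudaNakayamaFinite`, (G)
`FukudaGroupStep` landed): it turns Fukuda's standing hypothesis `TotallyRamifiedFrom κ n₀` (stated on the inertia groups
`I_𝔓 ≤ Γ_K` of the primes `𝔓` of `\bar ℤ_K`: `I_𝔓 ≤ ker κ` or `Gal(K̄/K_{n₀}) ≤ I_𝔓 · ker κ`) into the finite-level statement the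
group-theoretic step consumes: for `n₀ ≤ n ≤ m` and every maximal ideal `Q` of `𝓞 K_m`, the inertia group `I(Q) ≤ Gal(K_m/K)` is
EITHER trivial (`Q` unramified over `K`) OR contains `Gal(K_m/K_n)` — every automorphism fixing `K_n` pointwise (`Q` totally
ramified over `K_n`). PROOF: lift `Q` to a prime `𝔔` of `\bar ℤ_K` (going up along `𝓞 K_m ↪ \bar ℤ_K`); `I(Q) = I_𝔔|_{K_m}`
(Serre, *Local Fields* I §7 Prop. 22 (b), tree `exists_mem_inertia_absRestrictNormalHom_eq_of_comap` and the equivariance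
`ringOfIntegersToIntegralClosure_absRestrictNormalHom_smul`); `σ|_{K_m} = 1 ↔ σ ∈ κ⁻¹(p^m ℤ_p)`
(`ZpExtension.absRestrictNormalHom_layer_eq_one_iff`) and `ker κ ≤ κ⁻¹(p^m ℤ_p)`; in the second case an automorphism fixing
`K_n` lifts to `σ ∈ κ⁻¹(pⁿℤ_p) ≤ κ⁻¹(p^{n₀}ℤ_p) ≤ I_𝔔 · ker κ`, `σ = i k`, and `σ|_{K_m} = i|_{K_m} ∈ I(Q)`.

References: [Washington1997] §13.1 Prop. 13.2, §13.3 (Lemma 13.15: «assume all primes which ramify in `K_∞/K` are totally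
ramified»); [Fukuda1994] p. 264 (the index `n₀`); [SerreLocalFields1979] Ch. I §7 Prop. 22 (b); [NeukirchANT1999] Ch. I §9.
-/

noncomputable section

open scoped NumberField
open NumberField IsDedekindDomain Field IntermediateField

namespace Literature.NumberTheory.EllipticCurves.ZpExtension

open Literature.NumberTheory.GaloisRepresentations Literature.NumberTheory.IwasawaTheory

variable {K : Type} [Field K] [NumberField K] {p : ℕ} [Fact p.Prime] (κ : ZpExtension K p)

/-- **Inertia dichotomy in the layers of a `ℤ_p`-extension with Fukuda index `n₀`.** If every prime ramified in `K_∞/K` is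
totally ramified in `K_∞/K_{n₀}` (`TotallyRamifiedFrom κ n₀`) and `n₀ ≤ n ≤ m`, then for every maximal ideal `Q` of `𝓞 K_m` the
inertia group `I(Q) ≤ Gal(K_m/K)` is trivial, or it contains every `K`-automorphism of `K_m` fixing `K_n` pointwise (i.e.
`I(Q) ⊇ Gal(K_m/K_n)`: `Q` is totally ramified over `K_n`). [cite: Washington1997, §13.3 Lemma 13.15 (standing assumption) and
§13.1 Prop. 13.2] [cite: Fukuda1994, p. 264 (the index `n₀`)] [cite: SerreLocalFields1979, Ch. I §7 Prop. 22(b)] -/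
theorem inertia_layer_eq_bot_or_forall_mem {n₀ n m : ℕ} (hκ : TotallyRamifiedFrom κ n₀) (hn : n₀ ≤ n) (hnm : n ≤ m)
    [FiniteDimensional K (κ.layer m)] [IsGalois K (κ.layer m)]
    (Q : Ideal (𝓞 (κ.layer m))) [Q.IsMaximal] :
    Q.inertia ((κ.layer m) ≃ₐ[K] (κ.layer m)) = ⊥ ∨
      ∀ g : (κ.layer m) ≃ₐ[K] (κ.layer m),
        (∀ x : κ.layer m, (x : AlgebraicClosure K) ∈ κ.layer n → g x = x) →
          g ∈ Q.inertia ((κ.layer m) ≃ₐ[K] (κ.layer m)) := by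
  classical
  haveI : NumberField (κ.layer m) := NumberField.of_module_finite K (κ.layer m)
  set ι := EllipticCurves.ringOfIntegersToIntegralClosure (k := K) (Ω := AlgebraicClosure K) (κ.layer m) with hιdef
  have hιalg : ∀ x : 𝓞 K, ι (algebraMap (𝓞 K) (𝓞 (κ.layer m)) x) = algebraMap (𝓞 K) (absIntegers (𝓞 K) K) x := fun x => rfl
  -- lift `Q` to a prime `𝔔` of `\bar ℤ_K`
  obtain ⟨𝔔, h𝔔prime, h𝔔Q⟩ : ∃ 𝔔 : Ideal (absIntegers (𝓞 K) K), 𝔔.IsPrime ∧ 𝔔.comap ι = Q := by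
    letI : Algebra (𝓞 (κ.layer m)) (absIntegers (𝓞 K) K) := ι.toAlgebra
    haveI : IsScalarTower (𝓞 K) (𝓞 (κ.layer m)) (absIntegers (𝓞 K) K) :=
      IsScalarTower.of_algebraMap_eq fun x => (hιalg x).symm
    haveI : Algebra.IsIntegral (𝓞 (κ.layer m)) (absIntegers (𝓞 K) K) :=
      ⟨fun x => (Algebra.IsIntegral.isIntegral (R := 𝓞 K) x).tower_top⟩
    obtain ⟨𝔔, -, h𝔔prime, h𝔔Q⟩ := Ideal.exists_ideal_over_prime_of_isIntegral Q
      (⊥ : Ideal (absIntegers (𝓞 K) K))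
      (fun x hx => by
        rw [Ideal.mem_comap, Ideal.mem_bot] at hx
        have hx0 : x = 0 :=
          EllipticCurves.ringOfIntegersToIntegralClosure_injective (κ.layer m) (hx.trans (map_zero _).symm)
        rw [hx0]
        exact Q.zero_mem)
    exact ⟨𝔔, h𝔔prime, h𝔔Q⟩
  haveI := h𝔔prime
  -- the place `w` of `K` below `Q`, and `𝔔 ∣ w`
  have hQ0 : Q ≠ ⊥ := Ring.ne_bot_of_isMaximal_of_not_isField ‹_› (RingOfIntegers.not_isField (κ.layer m))
  have hw0 : Q.under (𝓞 K) ≠ ⊥ := mt Ideal.eq_bot_of_comap_eq_bot hQ0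
  haveI : (Q.under (𝓞 K)).IsMaximal := Ideal.IsMaximal.under (𝓞 K) Q
  let w : HeightOneSpectrum (𝓞 K) := ⟨Q.under (𝓞 K), Ideal.IsMaximal.isPrime ‹_›, hw0⟩
  have h𝔔w : 𝔔 ∈ w.primesAbove := by
    refine ⟨h𝔔prime, ⟨?_⟩⟩
    ext r
    change r ∈ Q.under (𝓞 K) ↔ r ∈ 𝔔.under (𝓞 K)
    rw [Ideal.under, Ideal.under, Ideal.mem_comap, Ideal.mem_comap, ← h𝔔Q, Ideal.mem_comap]
    exact Iff.of_eq (congrArg (· ∈ 𝔔) (hιalg r))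
  -- restriction kills `ker κ` and `κ⁻¹(p^m ℤ_p)` on `K_m`
  have hres_one : ∀ k ∈ κ.layerSubgroup m, absRestrictNormalHom (κ.layer m) k = 1 := fun k hk =>
    (κ.absRestrictNormalHom_layer_eq_one_iff m k).mpr hk
  rcases hκ w 𝔔 h𝔔w with h1 | h2
  · -- `I_𝔔 ≤ ker κ`: the inertia group of `Q` is trivial
    left
    rw [eq_bot_iff]
    intro g hg
    have hg' : g ∈ (𝔔.comap ι).inertia ((κ.layer m) ≃ₐ[K] (κ.layer m)) := by rw [h𝔔Q]; exact hg
    obtain ⟨σ, hσ, rfl⟩ := exists_mem_inertia_absRestrictNormalHom_eq_of_comap (κ.layer m) hg'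
    rw [Subgroup.mem_bot]
    exact hres_one σ (κ.kerSubgroup_le_layerSubgroup m (h1 hσ))
  · -- `Gal(K̄/K_{n₀}) ≤ I_𝔔 · ker κ`: every automorphism fixing `K_n` is inertial at `Q`
    right
    intro g hgfix
    obtain ⟨σ₀, hσ₀⟩ := AlgEquiv.restrictNormalHom_surjective (F := K) (K₁ := κ.layer m)
      (E := AlgebraicClosure K) g
    set σ : absoluteGaloisGroup K := (absoluteGaloisGroup.toAlgEquiv K).symm σ₀ with hσdef
    have hσg : absRestrictNormalHom (κ.layer m) σ = g := by
      rw [← hσ₀]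
      change AlgEquiv.restrictNormalHom (κ.layer m) (absoluteGaloisGroup.toAlgEquiv K ((absoluteGaloisGroup.toAlgEquiv K).symm σ₀)) = _
      rw [MulEquiv.apply_symm_apply]
    -- `σ` fixes `K_n` pointwise
    have hσn : σ ∈ κ.layerSubgroup n := by
      rw [κ.mem_layerSubgroup_iff_forall_smul n]
      intro x hx
      have hxm : x ∈ κ.layer m := κ.layer_mono hnm hx
      have h3 := hgfix ⟨x, hxm⟩ hx
      rw [← hσg] at h3
      have h4 := AlgEquiv.restrictNormalHom_apply (κ.layer m) (absoluteGaloisGroup.toAlgEquiv K σ) ⟨x, hxm⟩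
      -- `↑(σ|_M ⟨x⟩) = σ • x`
      change ((absRestrictNormalHom (κ.layer m) σ ⟨x, hxm⟩ : κ.layer m) : AlgebraicClosure K) = _ at h4
      rw [h3] at h4
      rw [absoluteGaloisGroup.smul_def]
      exact h4.symm
    have hσmem : σ ∈ 𝔔.inertia (absoluteGaloisGroup K) ⊔ κ.kerSubgroup := h2 (κ.layerSubgroup_antitone hn hσn)
    haveI : κ.kerSubgroup.Normal := by
      change (κ.toContinuousMonoidHom.toMonoidHom.ker).Normal
      infer_instance
    rw [Subgroup.mem_sup_of_normal_right] at hσmem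
    obtain ⟨i, hi, k, hk, hik⟩ := hσmem
    rw [← hσg, ← hik, map_mul, hres_one k (κ.kerSubgroup_le_layerSubgroup m hk), mul_one]
    -- `i|_{K_m} ∈ I(Q)`
    rw [← h𝔔Q]
    intro y
    have h4 : ι (absRestrictNormalHom (κ.layer m) i • y - y) ∈ 𝔔 := by
      rw [map_sub ι, hιdef, ringOfIntegersToIntegralClosure_absRestrictNormalHom_smul]
      exact hi _
    exact Ideal.mem_comap.mpr h4

end Literature.NumberTheory.EllipticCurves.ZpExtension

end
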